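import Summits.KontsevichZagierPeriods.KontsevichZagierPeriods.Theorems.HoffmanRelationInKZ.Negative.HoffmanElement

/-!
# Crux `HoffmanRelationInKZ` (stmt-KontsevichZagierPeriods-3930): the window invariant — a non-additive move is needed

Landed copy of §3b (general part and weight 3) of `Cruxes/HoffmanRelationInKZ/Disproof.lean` (crux
disprover). For a fixed family of measurable windows `A n ⊆ ℝⁿ`, `[σ, f] ↦ ∫_{σ ∩ A n} f` is additive in
the domain and in the integrand, so it kills the sub-calculus `addOnly` generated by the two additivity
moves (`addOnly_le_ker_windowEval`); it is not invariant under changes of variables or Newton–Leibniz.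
On the box `(1/2,3/5) × (3/10,2/5) × (1/10,1/5)` inside the simplex, where `1/t₁ > 1/(1 − t₁)`, it is
positive on Hoffman's element at `s = (2)` (`windowEval_hoffmanElement_two_pos`): **any move-proof of
Euler's `ζ(3) = ζ(2,1)` uses a change of variables or a Newton–Leibniz move** (`two_not_mem_addOnly`).
Weight 4 (`s = (3)`): `WindowWeightFour.lean`.

Reference: M. Kontsevich, D. Zagier, *Periods* (2001), §1.2.
-/

noncomputable section

namespace Summit.KontsevichZagierPeriods.HoffmanRelationInKZ.Negative

open MeasureTheory Set
open Literature.NumberTheory.Transcendental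
open Literature.NumberTheory.Transcendental.KZ
open Summit.KontsevichZagierPeriods.KontsevichZagierPeriods.Theses.FurushoPentagon

/-! ## Window evaluation: the additivity moves alone do not prove `s = (2)`

For a fixed family of measurable windows `A n ⊆ ℝⁿ`, `[σ, f] ↦ ∫_{σ ∩ A n} f` is additive in the domain
(null overlaps stay null) and in the integrand, so it kills the sub-calculus `addOnly` generated by the
two additivity moves; it is NOT invariant under changes of variables or Newton–Leibniz. On a small box
inside the simplex where `ω₀(t₁) = 1/t₁` beats `ω₁(t₁) = 1/(1 − t₁)` it separates Hoffman's elements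
at `s = (2)` and `s = (3)` from `0`: **any move-proof of Euler's `ζ(3) = ζ(2,1)` or of
`ζ(4) = ζ(3,1) + ζ(2,2)` uses a change of variables or a Newton–Leibniz (Stokes) move.** Together with
§3a: a proof of the first live instance `s = (3)` uses an additivity move AND a non-additive move. -/

section Window

/-- Box windows in every dimension, with endpoints read off two sequences. -/
def window (a b : ℕ → ℝ) (n : ℕ) : Set (Fin n → ℝ) := {t | ∀ i : Fin n, t i ∈ Ioo (a i) (b i)}

/-- A window is a product of open intervals. [folklore] -/
theorem window_eq_pi (a b : ℕ → ℝ) (n : ℕ) :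
    window a b n = Set.pi univ fun i : Fin n => Ioo (a i) (b i) := by
  ext t; simp [window]

/-- Windows are open. [folklore] -/
theorem isOpen_window (a b : ℕ → ℝ) (n : ℕ) : IsOpen (window a b n) := by
  rw [window_eq_pi]
  exact isOpen_set_pi finite_univ fun i _ => isOpen_Ioo

/-- Windows are measurable. [folklore] -/
theorem measurableSet_window (a b : ℕ → ℝ) (n : ℕ) : MeasurableSet (window a b n) :=
  (isOpen_window a b n).measurableSet

/-- **Window evaluation** `[σ, f] ↦ ∫_{σ ∩ A n} f`. -/
def windowEval (A : (n : ℕ) → Set (Fin n → ℝ)) : FormalRep →+ ℝ :=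
  FreeAbelianGroup.lift fun r => ∫ x in r.2.domain ∩ A r.1, r.2.integrand x

/-- Window evaluation of a generator. [folklore] -/
@[simp] theorem windowEval_of (A : (n : ℕ) → Set (Fin n → ℝ)) {n : ℕ} (r : IntegralRep n) :
    windowEval A (of r) = ∫ x in r.domain ∩ A n, r.integrand x :=
  FreeAbelianGroup.lift_apply_of _ _

/-- The sub-calculus generated by the two additivity moves only. -/
def addOnly : AddSubgroup FormalRep := AddSubgroup.closure (domainAddRel ∪ integrandAddRel)

/-- `addOnly ≤ relations`. [folklore] -/
theorem addOnly_le_relations : addOnly ≤ relations :=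
  AddSubgroup.closure_mono (by
    rintro c (hc | hc)
    · exact Or.inl (Or.inl (Or.inl hc))
    · exact Or.inl (Or.inl (Or.inr hc)))

/-- **Window evaluation kills `addOnly`.** [folklore] -/
theorem addOnly_le_ker_windowEval {A : (n : ℕ) → Set (Fin n → ℝ)} (hA : ∀ n, MeasurableSet (A n)) :
    addOnly ≤ (windowEval A).ker := by
  refine (AddSubgroup.closure_le _).mpr ?_
  rintro c (hc | hc)
  · obtain ⟨n, r, r₁, r₂, hdom, hnull, h₁, h₂, rfl⟩ := hc
    simp only [SetLike.mem_coe, AddMonoidHom.mem_ker, map_sub, windowEval_of]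
    rw [sub_sub, sub_eq_zero]
    have hm₁ : MeasurableSet (r₁.domain ∩ A n) := (IntegralRep.measurableSet_domain_holds r₁).inter (hA n)
    have hm₂ : MeasurableSet (r₂.domain ∩ A n) := (IntegralRep.measurableSet_domain_holds r₂).inter (hA n)
    have hsub : (r₁.domain ∩ A n) ∩ (r₂.domain ∩ A n) ⊆ r₁.domain ∩ r₂.domain :=
      fun x hx => ⟨hx.1.1, hx.2.1⟩
    have hae : AEDisjoint volume (r₁.domain ∩ A n) (r₂.domain ∩ A n) := measure_mono_null hsub hnull
    have hunion : r.domain ∩ A n = (r₁.domain ∩ A n) ∪ (r₂.domain ∩ A n) := by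
      rw [hdom, Set.union_inter_distrib_right]
    have hi₁ : IntegrableOn r.integrand (r₁.domain ∩ A n) :=
      r.integrableOn.mono_set (by rw [hdom]; exact inter_subset_left.trans subset_union_left)
    have hi₂ : IntegrableOn r.integrand (r₂.domain ∩ A n) :=
      r.integrableOn.mono_set (by rw [hdom]; exact inter_subset_left.trans subset_union_right)
    rw [hunion, setIntegral_union₀ hae hm₂.nullMeasurableSet hi₁ hi₂,
      setIntegral_congr_fun hm₁ (h₁.mono inter_subset_left),
      setIntegral_congr_fun hm₂ (h₂.mono inter_subset_left)]
  · obtain ⟨n, r, r₁, r₂, h₁, h₂, hadd, rfl⟩ := hc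
    simp only [SetLike.mem_coe, AddMonoidHom.mem_ker, map_sub, windowEval_of]
    rw [sub_sub, sub_eq_zero, h₁, h₂]
    have hm : MeasurableSet (r.domain ∩ A n) := (IntegralRep.measurableSet_domain_holds r).inter (hA n)
    rw [setIntegral_congr_fun hm (hadd.mono inter_subset_left)]
    exact integral_add ((h₁ ▸ r₁.integrableOn).mono_set inter_subset_left)
      ((h₂ ▸ r₂.integrableOn).mono_set inter_subset_left)

/-- A function positive on a nonempty open set, integrable there, has positive integral. [folklore] -/
theorem setIntegral_pos_of_pos_on {n : ℕ} {U : Set (Fin n → ℝ)} (hU : IsOpen U) (hne : U.Nonempty)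
    {f : (Fin n → ℝ) → ℝ} (hf : ∀ x ∈ U, 0 < f x) (hfi : IntegrableOn f U) : 0 < ∫ x in U, f x := by
  have h0 : 0 ≤ᵐ[volume.restrict U] f := by
    rw [Filter.EventuallyLE, ae_restrict_iff' hU.measurableSet]
    exact Filter.Eventually.of_forall fun x hx => (hf x hx).le
  rw [setIntegral_pos_iff_support_of_nonneg_ae h0 hfi]
  have : Function.support f ∩ U = U := Set.inter_eq_right.mpr fun x hx => (hf x hx).ne'
  rw [this]
  exact hU.measure_pos volume hne

/-- The integrand of `ζ(3)`: `ω₀ω₀ω₁`. -/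
theorem mzvIntegrand_three (t : Fin 3 → ℝ) :
    mzvIntegrand [3] t = (t 0)⁻¹ * (t 1)⁻¹ * (1 - t 2)⁻¹ := by
  change (∏ i : Fin 3, mzvForm ((MZV.binaryWord [3]).getD i false) (t i)) = _
  simp [Fin.prod_univ_three, mzvForm, MZV.binaryWord]

/-- The integrand of `ζ(2,1)`: `ω₀ω₁ω₁`. -/
theorem mzvIntegrand_two_one (t : Fin 3 → ℝ) :
    mzvIntegrand [2, 1] t = (t 0)⁻¹ * (1 - t 1)⁻¹ * (1 - t 2)⁻¹ := by
  change (∏ i : Fin 3, mzvForm ((MZV.binaryWord [2, 1]).getD i false) (t i)) = _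
  simp [Fin.prod_univ_three, mzvForm, MZV.binaryWord]

/-- Lower endpoints of the weight-3 box `(1/2,3/5) × (3/10,2/5) × (1/10,1/5)`. -/
def lo₃ : ℕ → ℝ := fun i => (([1/2, 3/10, 1/10] : List ℚ).getD i 0 : ℚ)
/-- Upper endpoints of the weight-3 box. -/
def hi₃ : ℕ → ℝ := fun i => (([3/5, 2/5, 1/5] : List ℚ).getD i 0 : ℚ)

/-- Coordinates of a point of the weight-3 box. [folklore] -/
theorem mem_window₃ {t : Fin 3 → ℝ} (ht : t ∈ window lo₃ hi₃ 3) :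
    1/2 < t 0 ∧ t 0 < 3/5 ∧ 3/10 < t 1 ∧ t 1 < 2/5 ∧ 1/10 < t 2 ∧ t 2 < 1/5 := by
  have h0 := ht 0; have h1 := ht 1; have h2 := ht 2
  simp only [lo₃, hi₃, mem_Ioo] at h0 h1 h2
  norm_num at h0 h1 h2
  exact ⟨h0.1, h0.2, h1.1, h1.2, h2.1, h2.2⟩

/-- The weight-3 box lies in the open ordered simplex. [folklore] -/
theorem window₃_subset : window lo₃ hi₃ 3 ⊆ openOrderedSimplex 3 := by
  intro t ht
  obtain ⟨h0, h0', h1, h1', h2, h2'⟩ := mem_window₃ ht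
  refine ⟨fun i => ?_, fun i => ?_, fun i j hij => ?_⟩
  · fin_cases i <;> simp <;> linarith
  · fin_cases i <;> simp <;> linarith
  · fin_cases i <;> fin_cases j <;> simp at hij ⊢ <;> linarith

/-- The weight-3 box is nonempty. [folklore] -/
theorem window₃_nonempty : (window lo₃ hi₃ 3).Nonempty := by
  refine ⟨![11/20, 7/20, 3/20], fun i => ?_⟩
  fin_cases i <;> simp [lo₃, hi₃] <;> norm_num

/-- **The window separates `H(2)` from `0`**: `∫_B (ω₀ω₀ω₁ − ω₀ω₁ω₁) > 0` on the box `B`, where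
`1/t₁ > 1/(1 − t₁)`. -/
theorem windowEval_hoffmanElement_two_pos : 0 < windowEval (window lo₃ hi₃) (hoffmanElement zetaRep [2]) := by
  have h3 : MZV.IsAdmissible [3] := by decide
  have h21 : MZV.IsAdmissible [2, 1] := by decide
  rw [hoffmanElement_two, zetaRep_of_isAdmissible h3, zetaRep_of_isAdmissible h21, map_sub, windowEval_of,
    windowEval_of]
  change 0 < (∫ x in openOrderedSimplex 3 ∩ window lo₃ hi₃ 3, mzvIntegrand [3] x) -
    ∫ x in openOrderedSimplex 3 ∩ window lo₃ hi₃ 3, mzvIntegrand [2, 1] x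
  rw [inter_eq_right.mpr window₃_subset]
  have hi3 : IntegrableOn (fun x : Fin 3 → ℝ => mzvIntegrand [3] x) (window lo₃ hi₃ 3) :=
    (mzvIntegrand_integrableOn_holds [3] h3).mono_set window₃_subset
  have hi21 : IntegrableOn (fun x : Fin 3 → ℝ => mzvIntegrand [2, 1] x) (window lo₃ hi₃ 3) :=
    (mzvIntegrand_integrableOn_holds [2, 1] h21).mono_set window₃_subset
  rw [← integral_sub hi3 hi21]
  refine setIntegral_pos_of_pos_on (isOpen_window _ _ _) window₃_nonempty (fun t ht => ?_) (hi3.sub hi21)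
  obtain ⟨h0, h0', h1, h1', h2, h2'⟩ := mem_window₃ ht
  rw [mzvIntegrand_three, mzvIntegrand_two_one]
  have A : 0 < (t 0)⁻¹ := by positivity
  have B : 0 < (1 - t 2)⁻¹ := inv_pos.mpr (by linarith)
  have C : (1 - t 1)⁻¹ < (t 1)⁻¹ := by
    rw [inv_lt_inv₀ (by linarith) (by linarith)]; linarith
  have e : (t 0)⁻¹ * (t 1)⁻¹ * (1 - t 2)⁻¹ - (t 0)⁻¹ * (1 - t 1)⁻¹ * (1 - t 2)⁻¹ =
      (t 0)⁻¹ * (1 - t 2)⁻¹ * ((t 1)⁻¹ - (1 - t 1)⁻¹) := by ring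
  rw [e]
  exact mul_pos (mul_pos A B) (sub_pos.mpr C)

/-- **Additivity alone does not prove Euler's instance `s = (2)`**: any move-proof of `ζ(3) = ζ(2,1)`
uses a change of variables or a Newton–Leibniz move. [folklore] -/
theorem two_not_mem_addOnly : hoffmanElement zetaRep [2] ∉ addOnly := by
  intro h
  have h0 := addOnly_le_ker_windowEval (A := window lo₃ hi₃) (fun n => measurableSet_window _ _ n) h
  rw [AddMonoidHom.mem_ker] at h0
  exact (windowEval_hoffmanElement_two_pos).ne' h0

end Window

end Summit.KontsevichZagierPeriods.HoffmanRelationInKZ.Negative
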